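import Literature.AnabelianGeometry.EtaleTheta.ThetaRootOrbitsMonodromyToyLoopCor28i
import Literature.AnabelianGeometry.EtaleTheta.ThetaRootOrbitsMonodromyToyCor28iii
import HarnessLib

/-!
# [EtTh] Cor. 2.8 (iii) at the LOOP-CUT monodromy toy (PROOF-ONLY rider): the typed `Cor28_iii` HOLDS at
# `thetaOrbitDataLoop l hl` — inner automorphisms from the dotted members fix `η̈^{Θ,l·ℤ} = {η₀}` and permute the roots

S. Mochizuki, *The étale theta function and its Frobenioid-theoretic manifestations* [EtTh], Publ. RIMS **45**
(2009), §2 Cor. 2.8 (iii) p. 42 («if … `γ` arises from an inner automorphism of `Π^tp_{Ẋ̲̲}` (resp. `Π^tp_{Ẋ̲}`; `Π^tp_{Ċ̲̲}`;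
`Π^tp_{Ċ̲}`), then `γ` preserves `η̲̈^{Θ,l·ℤ}` (resp. `η̈^{Θ,l·ℤ}`; `η̲̈^{Θ,l·ℤ}`; `η̈^{Θ,l·ℤ}`)»), Def. 2.5 p. 39, Prop. 2.2 (i)
p. 37 (PRIMS text pages) [cite: MochizukiEtTh2009, Cor 2.8(iii) p.42].  Cell `abc-iut`, F lane (FACT-LIST row F-0641
`ThetaOrbitData.Cor28_iii`; count-neutral rider — abc-iut-F-lit 15:46Z: «F-0641 needs nothing; its T′ instance rides
along»), seat abc-iut-f-128 (gen 14); abc-iut-L2-lead R1553.  Carrier `monodromyModelLoop l hl`, datum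
`thetaOrbitDataLoop l hl` (`ThetaCoversMonodromyModelLoop{Shadow,}.lean`, `ThetaRootOrbitsMonodromyToyLoop.lean`).

RESULT ★ `cor28_iii_thetaOrbitDataLoop : (thetaOrbitDataLoop l hl).Cor28_iii` (every odd `l`): for `x` in a dotted member
`Π^tp_{Ċ̲} ⊇ Π^tp_{Ẋ̲}, Π^tp_{Ċ̲̲}, Π^tp_{Ẋ̲̲}` of the loop-cut toy, `x = (v, d, e)` has `d̄ ∈ {1, s}` — a rotation by a
MULTIPLE OF `l` (acting trivially on `Π^tp_Ÿ = (ℤ/l)²`) or a reflection `s r^j`, `l ∣ j` (acting by `(b, c) ↦ (−b, c)`) —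
so `γ_x` fixes the `c`-coordinate, hence `η₀ = [z^c]` EXACTLY (`cC_conj_of_mem_tp_PiCu_loop`,
`transport_etaCollLZ_eq_inner_loop`); the root collection (all `l`-th roots) is carried onto itself by every admissible
transport (part `…LoopCor28i`).  Contrast ★ `not_cor28_iii` at the `a`-cycle-cut toy, where `t ∈ Π^tp_{Ẋ̲}` translates
`η₀`: again the whole difference is Def. 2.5 (i)(a).

HONEST LABEL (abc-iut-L2-lead R1352, verbatim, inherited): «a DESIGNED tempered toy with print's monodromy combinatorics —
loop ↦ `Δ̄^ell` (`b`-cycle), the inversion INVERTS it, unipotent monodromy `x ↦ x·z` on the `a`-cycle, `z` = cusp inertia =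
`Δ̄_Θ` central; `G_K := 1`; NOT a Tate curve, NOT the tempered fundamental group of a curve; consistency ≠ faithfulness;
nothing here takes a side on anything printed.»  DEGENERATE in the `G_K`/`μ_l` directions (roots := all `l`-th roots);
PROOF-ONLY (0 `def`, 0 `instance`, 0 notation); a toy instance of OUR typed predicate ≠ [EtTh] Cor. 2.8 (iii) in print;
the positive instance forms at genuine carriers (abc-iut-L2-t2 `ofEmbedding_cor28_iii_inner`, the χ′ cover of record) are
the natural ones; no bearing on [IUTchIII] Cor. 3.12; no side taken; typed ≠ proved; count-neutral.
-/

noncomputable section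

namespace Literature.AnabelianGeometry.EtaleTheta.ThetaCovers.MonodromyModel

open Multiplicative HeisenbergWitness TemperedModel DihedralGroup ThetaOrbitData

variable (l : ℕ) [NeZero l] (hl : Odd l)

/-- The conjugation action of `Π^tp_C` on `Δ_Θ` of the loop-cut datum is trivial (`z` central). (toy bookkeeping)
[cite: MochizukiEtTh2009, Cor 2.8(iii) p.42] -/
theorem act_eq_self_loop (x : TG l) (a : DTh l) : (thetaOrbitDataLoop l hl).act x a = a := by
  induction a using QuotientGroup.induction_on with
  | H τ =>
    rw [ThetaOrbitData.act_mk]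
    congr 1
    exact Subtype.ext (conj_eq_of_mem_thetaTop l x τ.2)

/-- **An element of `Π^tp_{C̲} = {d̄ ∈ {1, s}}` of the loop-cut toy conjugates `Π^tp_Ÿ` WITHOUT moving the
`c`-coordinate** (rotations by multiples of `l` act trivially on `(ℤ/l)²`; reflections `s r^j`, `l ∣ j`, act by
`(b, c) ↦ (−b, c)`). (toy bookkeeping for [EtTh] Cor. 2.8 (iii); no claim about print) [cite: MochizukiEtTh2009, Cor 2.8(iii) p.42] -/
theorem cC_conj_of_mem_tp_PiCu_loop {x : TG l}
    (hx : x ∈ (monodromyModelLoop l hl).tp (monodromyModelLoop l hl).PiCu) {y : TG l} (hy : y ∈ PiYddT l) :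
    cC l (x * y * x⁻¹) = cC l y ∧ x * y * x⁻¹ ∈ PiYddT l := by
  have hy' : x * y * x⁻¹ ∈ PiYddT l := (PiYddT_normal l).conj_mem _ hy _
  refine ⟨?_, hy'⟩
  rw [tp_PiCu_loop, (mem_loop_members_iff l x).2.1] at hx
  obtain ⟨hd, he⟩ := (mem_PiYddT_iff l y).mp hy
  rcases hxr : x.1.right with i | j
  · -- a rotation `r^i` with `i ≡ 0 (mod l)`
    rw [hxr, dihedralRed_r] at hx
    have hi : ZMod.castHom (dvd_zero l) (ZMod l) i = 0 := by
      rcases hx with h | h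
      · rw [one_def] at h; injection h
      · cases h
    simp only [cC_mul, cC_inv, bC_inv, right_mul, hxr, hd, mul_one, dihedralRed_r, hi, ← one_def, inv_one,
      rotIdx_one]
    ring
  · -- a reflection `s r^j` with `j ≡ 0 (mod l)`
    rw [hxr, dihedralRed_sr] at hx
    have hj : ZMod.castHom (dvd_zero l) (ZMod l) j = 0 := by
      rcases hx with h | h
      · rw [one_def] at h; cases h
      · injection h
    exact (conj_coords_of_sr l hxr hj hy).2.2.1

/-- **Inner automorphisms from `Π^tp_{C̲}` of the loop-cut toy fix the toy theta class**: the transport of `η₀` along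
`(γ_x, Γ_Θ)` (`Γ_Θ` induced, i.e. the identity) is `η₀`. (toy bookkeeping for [EtTh] Cor. 2.8 (iii); no claim about print)
[cite: MochizukiEtTh2009, Cor 2.8(iii) p.42] -/
theorem transportFn_etaFn_one_zero_inner_loop {x : TG l}
    (hx : x ∈ (monodromyModelLoop l hl).tp (monodromyModelLoop l hl).PiCu) {ΓΘ : DTh l ≃* DTh l}
    (hind : (thetaOrbitDataLoop l hl).InducesOnTheta (innerAutTop (T := monodromyModelLoop l hl) x) ΓΘ)
    (hY : (PiYddT l).map (innerAutTop (T := monodromyModelLoop l hl) x).toMulEquiv.toMonoidHom = PiYddT l) :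
    (fun g : ↥(PiYddT l) => ΓΘ.symm (etaFn l 1 0 ⟨innerAutTop (T := monodromyModelLoop l hl) x g,
      mem_of_map_eq (T := monodromyModelLoop l hl) hY g⟩)) = etaFn l 1 0 := by
  have hΓΘ : ∀ a, ΓΘ.symm a = a := fun a => by
    rw [MulEquiv.symm_apply_eq, (thetaOrbitDataLoop l hl).inducesOnTheta_innerAutTop_eq_act hind, act_eq_self_loop]
  funext g
  rw [hΓΘ, etaFn_apply, etaFn_apply]
  congr 2
  show 1 * cC l (x * g * x⁻¹) + 0 * bC l (x * g * x⁻¹) = 1 * cC l g + 0 * bC l g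
  rw [(cC_conj_of_mem_tp_PiCu_loop l hl hx g.2).1, zero_mul, zero_mul]

/-- **`η̈^{Θ,l·ℤ} = {η₀}` is carried onto itself** by every inner automorphism from `Π^tp_{C̲}` of the loop-cut toy.
(toy bookkeeping for [EtTh] Cor. 2.8 (iii); no claim about print) [cite: MochizukiEtTh2009, Cor 2.8(iii) p.42] -/
theorem transport_etaCollLZ_eq_inner_loop {x : TG l}
    (hx : x ∈ (monodromyModelLoop l hl).tp (monodromyModelLoop l hl).PiCu) {ΓΘ : DTh l ≃* DTh l}
    (hind : (thetaOrbitDataLoop l hl).InducesOnTheta (innerAutTop (T := monodromyModelLoop l hl) x) ΓΘ)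
    (hY : (PiYddT l).map (innerAutTop (T := monodromyModelLoop l hl) x).toMulEquiv.toMonoidHom = PiYddT l) :
    (thetaOrbitDataLoop l hl).transport (PiYddT l) (innerAutTop (T := monodromyModelLoop l hl) x) hY ΓΘ (etaCollLZ l) =
      etaCollLZ l := by
  unfold ThetaOrbitData.transport etaCollLZ
  rw [Set.image_singleton, Set.image_singleton, transportFn_etaFn_one_zero_inner_loop l hl hx hind hY]

/-- `Π^tp_{X̲} ⊆ Π^tp_{C̲}` at the loop-cut toy. (toy bookkeeping) [cite: MochizukiEtTh2009, Def 2.5 p.39] -/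
theorem tp_PiXu_le_tp_PiCu_loop :
    (monodromyModelLoop l hl).tp (monodromyModelLoop l hl).PiXu ≤ (monodromyModelLoop l hl).tp (monodromyModelLoop l hl).PiCu := by
  rw [tp_PiXu_loop, tp_PiCu_loop]
  exact Subgroup.comap_mono (heis_le l).2.2.1

/-- **★ F-0641 GENUINE INSTANCE: the typed [EtTh] Cor. 2.8 (iii) `ThetaOrbitData.Cor28_iii` HOLDS at the print-recipe orbit
datum of the LOOP-CUT monodromy toy** (every odd `l`): inner automorphisms `γ_x` from the dotted members preserve
`η̈^{Θ,l·ℤ} = {η₀}` EXACTLY (`x ∈ Π^tp_{C̲}` fixes the `c`-coordinate) and the root collection (all `l`-th roots, carried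
onto itself by every admissible transport).  Contrast ★ `not_cor28_iii` at the `a`-cycle-cut toy.  HONEST LABEL: R1352
DESIGNED TOY; DEGENERATE in the `G_K`/`μ_l` directions; OUR typed predicate at a designed toy, not [EtTh] in print; no side
taken; typed ≠ proved. [cite: MochizukiEtTh2009, Cor 2.8(iii) p.42] -/
theorem cor28_iii_thetaOrbitDataLoop : (thetaOrbitDataLoop l hl).Cor28_iii := by
  intro x ΓΘ hind hY hYuu
  exact ⟨fun _ => transport_rootCollLoop_eq l hl _ ΓΘ hYuu,
    fun hx => transport_etaCollLZ_eq_inner_loop l hl (tp_PiXu_le_tp_PiCu_loop l hl hx.1) hind hY,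
    fun _ => transport_rootCollLoop_eq l hl _ ΓΘ hYuu,
    fun hx => transport_etaCollLZ_eq_inner_loop l hl hx.1 hind hY⟩

/-- **Both typed rigidity rows at both toys**: `Cor28_i ∧ Cor28_iii` HOLD at the loop-cut datum and FAIL at the
`a`-cycle-cut datum (`l ≠ 1`) — same `Π^tp_C`, `Π^tp_Ÿ`, `Δ_Θ`, same print-recipe `Ÿ`-collections; the difference is
Def. 2.5 (i)(a). [cite: MochizukiEtTh2009, Cor 2.8(iii) p.42] -/
theorem cor28_i_iii_loop_and_not_acycle (hl1 : l ≠ 1) :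
    ((thetaOrbitDataLoop l hl).Cor28_i ∧ (thetaOrbitDataLoop l hl).Cor28_iii) ∧
      (¬ (thetaOrbitData l hl).Cor28_i ∧ ¬ (thetaOrbitData l hl).Cor28_iii) :=
  ⟨⟨cor28_i_thetaOrbitDataLoop l hl, cor28_iii_thetaOrbitDataLoop l hl⟩, not_cor28_i l hl hl1, not_cor28_iii l hl hl1⟩

end Literature.AnabelianGeometry.EtaleTheta.ThetaCovers.MonodromyModel

end
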